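import Literature.Analysis.FluidPDE.BallAverageLimits
import HarnessLib

/-!
# Weighted ball averages through the covering map converge in `L^q((0,T) × T^d)`

Topic: Analysis/FluidPDE (torus tools, the weighted companion of
`Literature.Analysis.FluidPDE.BallAverageLimits`). For a jointly measurable space–time field
`u : ℝ → T^d → F` with `∫₀ᵀ∫ ‖u‖^q < ∞`, `1 ≤ q < ∞`, and **linear weights**
`w(y) : F → G` on the ball `B_ℓ ⊂ ℝ^d` — jointly continuous in `(y, v)`, bounded
(`‖w(y) v‖ ≤ C ‖v‖` on `B_ℓ`) and of **mass** `L` (`⨍_{B_ℓ} w(y) v dy = L v`) — the weighted ball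
average `x ↦ ⨍_{B_ℓ} w(y) u(t, x + y) dy` (the separation `y ∈ ℝ^d` acting through the covering
map `proj`) satisfies, all **proved**:

* `Torus.aestronglyMeasurable_weightedBallAverage` — joint measurability on `(0,T) × T^d`;
* `Torus.tendsto_ballAverage_translationModulus` — the ball-averaged translation modulus
  `|B_ℓ|⁻¹ ∫_{B_ℓ} ‖u(·, · + y) − u‖^q_{L^q((0,T) × T^d)} dy → 0` as `ℓ → 0⁺` (continuity of
  translation, `Torus.tendsto_lintegral_translate_sub`, and `‖proj y‖ ≤ ‖y‖ < ℓ`);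
* `Torus.lintegral_weightedBallAverage_rpow_le` — **weighted ball averages are bounded in `L^q`**:
  `∫₀ᵀ∫ ‖⨍_{B_ℓ} w(y) u(t, x + y) dy‖^q ≤ C^q ∫₀ᵀ∫ ‖u‖^q` (Jensen, Tonelli, translation invariance);
* `Torus.lintegral_weightedBallAverage_sub_rpow_le` — at a fixed scale,
  `∫₀ᵀ∫ ‖⨍_{B_ℓ} w(y) u(t, x + y) dy − L u(t, x)‖^q ≤ C^q |B_ℓ|⁻¹ ∫_{B_ℓ} ‖u(·, · + y) − u‖^q_{L^q} dy`
  (linearity and the mass identity turn the difference into `⨍_{B_ℓ} w(y) (u(t, x+y) − u(t, x)) dy`;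
  Jensen on the ball, `Torus.enorm_setAverage_rpow_le`; Tonelli);
* `Torus.tendsto_lintegral_weightedBallAverage_sub` — **weighted ball averages converge in
  `L^q((0,T) × T^d)`**: for a family of such weights `w_ℓ` with a uniform bound and a common mass
  `L` on `0 < ℓ < ℓ₀`, `∫₀ᵀ∫ ‖⨍_{B_ℓ} w_ℓ(y) u(t, x + y) dy − L u(t, x)‖^q → 0` as `ℓ → 0⁺`.

This is the `L^p` claim of Novack 2024, §2 Step 2 ((claim): `‖g_{L,ℓ} − (3/(d+2)) g‖_p → 0`
for the longitudinal kernel, "we use that `∫ ζ_ℓ = −2/(d+2)`, `∫ T_T = (d−1)/d` …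
`∫ T_L = δ/d`"), in the generality of an arbitrary bounded linear weight: the printed argument is
exactly "mass identity + approximate identity", i.e. Folland, *Real Analysis*, Thm. 8.14 (a) with
a matrix-valued kernel.

## References

* M. Novack, *Scaling laws and exact results in turbulence*, Nonlinearity 37 (2024) 095002,
  arXiv:2310.01375, §2 Step 2, (claim). [Novack2024]
* G. B. Folland, *Real Analysis*, 2nd ed., Thm. 8.14 (a). [Folland1999]
* Tree: `Torus.tendsto_lintegral_translate_sub`, `Torus.enorm_setAverage_rpow_le`,
  `Torus.aestronglyMeasurable_increment_proj` (`BallAverageLimits`),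
  `Torus.aestronglyMeasurable_translate` (`DuchonRobertShellLaw`).
-/

noncomputable section

open MeasureTheory TopologicalSpace Set Function Filter Metric
open _root_.Topology
open scoped ENNReal NNReal

namespace Literature.Analysis.FluidPDE.Torus

variable {d : Type*} [Fintype d] {F G : Type*} [NormedAddCommGroup F] [NormedAddCommGroup G]
  [NormedSpace ℝ G]

variable {T : ℝ} {u : ℝ → UnitAddTorus d → F}

/-! ## Measurability of weighted ball averages -/

section Measurability

omit [NormedSpace ℝ G] in
/-- The weighted translated field `((t,x), y) ↦ w(y) u t (x + proj y)` of a jointly measurable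
field is jointly a.e.-strongly measurable on `((0,T) × T^d) × ℝ^d`, for a weight jointly
continuous in `(y, v)` (any s-finite measure in `y`). [folklore] -/
theorem aestronglyMeasurable_weight_translate (ν : Measure (EuclideanSpace ℝ d)) [SFinite ν]
    (hu : AEStronglyMeasurable (uncurry u) ((volume.restrict (Ioo 0 T)).prod volume))
    {w : EuclideanSpace ℝ d → F → G} (hw : Continuous fun p : EuclideanSpace ℝ d × F => w p.1 p.2) :
    AEStronglyMeasurable
      (fun z : (ℝ × UnitAddTorus d) × EuclideanSpace ℝ d =>
        w z.2 (u z.1.1 (z.1.2 + FunctionSpaces.Torus.proj z.2)))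
      (((volume.restrict (Ioo 0 T)).prod volume).prod ν) :=
  hw.comp_aestronglyMeasurable₂ (g := w) measurable_snd.aestronglyMeasurable
    (aestronglyMeasurable_translate (ν := ν) hu FunctionSpaces.Torus.measurable_proj)

omit [NormedSpace ℝ G] in
/-- The weighted increment field `((t,x), y) ↦ w(y) (u t (x + proj y) − u t x)` is jointly
a.e.-strongly measurable on `((0,T) × T^d) × ℝ^d`. [folklore] -/
theorem aestronglyMeasurable_weight_increment (ν : Measure (EuclideanSpace ℝ d)) [SFinite ν]
    (hu : AEStronglyMeasurable (uncurry u) ((volume.restrict (Ioo 0 T)).prod volume))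
    {w : EuclideanSpace ℝ d → F → G} (hw : Continuous fun p : EuclideanSpace ℝ d × F => w p.1 p.2) :
    AEStronglyMeasurable
      (fun z : (ℝ × UnitAddTorus d) × EuclideanSpace ℝ d =>
        w z.2 (u z.1.1 (z.1.2 + FunctionSpaces.Torus.proj z.2) - u z.1.1 z.1.2))
      (((volume.restrict (Ioo 0 T)).prod volume).prod ν) :=
  hw.comp_aestronglyMeasurable₂ (g := w) measurable_snd.aestronglyMeasurable
    (aestronglyMeasurable_increment_proj ν hu)

/-- **Weighted ball averages are jointly measurable**: `(t, x) ↦ ⨍_{s} w(y) u t (x + proj y) dy`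
is a.e.-strongly measurable on `(0,T) × T^d` (a parametric Bochner integral). [folklore] -/
theorem aestronglyMeasurable_weightedBallAverage
    (hu : AEStronglyMeasurable (uncurry u) ((volume.restrict (Ioo 0 T)).prod volume))
    {w : EuclideanSpace ℝ d → F → G} (hw : Continuous fun p : EuclideanSpace ℝ d × F => w p.1 p.2)
    (s : Set (EuclideanSpace ℝ d)) :
    AEStronglyMeasurable
      (fun p : ℝ × UnitAddTorus d => ⨍ y in s, w y (u p.1 (p.2 + FunctionSpaces.Torus.proj y)))
      ((volume.restrict (Ioo 0 T)).prod volume) := by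
  have hW := aestronglyMeasurable_weight_translate (volume.restrict s) hu hw
  refine ((hW.integral_prod_right').const_smul (volume.real s)⁻¹).congr (ae_of_all _ fun p => ?_)
  simp only [Pi.smul_apply]
  rw [setAverage_eq]

end Measurability

/-! ## The ball-averaged translation modulus -/

section Modulus

/-- **The ball-averaged translation modulus tends to zero**: for a jointly measurable field `u`
with `∫₀ᵀ∫ ‖u‖^q < ∞`, `1 ≤ q`,
`|B_ℓ|⁻¹ ∫_{B_ℓ} (∫₀ᵀ∫ ‖u(t, x + y) − u(t, x)‖^q dx dt) dy → 0` as `ℓ → 0⁺`, the separation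
`y ∈ ℝ^d` acting through the covering map (continuity of translation in `L^q((0,T) × T^d)`,
`Torus.tendsto_lintegral_translate_sub`, and `‖proj y‖ ≤ ‖y‖ < ℓ`). [folklore] -/
theorem tendsto_ballAverage_translationModulus {q : ℝ} (hq : 1 ≤ q)
    (hu : AEStronglyMeasurable (uncurry u) ((volume.restrict (Ioo 0 T)).prod volume))
    (huq : ∫⁻ t in Ioo 0 T, ∫⁻ x, ‖u t x‖ₑ ^ q < ∞) :
    Tendsto (fun ℓ : ℝ => (volume (ball (0 : EuclideanSpace ℝ d) ℓ))⁻¹ *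
        ∫⁻ y in ball (0 : EuclideanSpace ℝ d) ℓ,
          ∫⁻ p, ‖u p.1 (p.2 + FunctionSpaces.Torus.proj y) - u p.1 p.2‖ₑ ^ q
            ∂((volume.restrict (Ioo 0 T)).prod volume)) (𝓝[>] 0) (𝓝 0) := by
  set μp : Measure (ℝ × UnitAddTorus d) := (volume.restrict (Ioo 0 T)).prod volume with hμp
  set Φ : UnitAddTorus d → ℝ≥0∞ := fun h => ∫⁻ p, ‖u p.1 (p.2 + h) - u p.1 p.2‖ₑ ^ q ∂μp with hΦ
  have hΦiter : ∀ h, ∫⁻ t in Ioo 0 T, ∫⁻ x, ‖u t (x + h) - u t x‖ₑ ^ q = Φ h := fun h => by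
    have hm : AEStronglyMeasurable (uncurry fun t x => u t (x + h) - u t x) μp :=
      (aestronglyMeasurable_uncurry_comp_add hu h).sub hu
    rw [hΦ]
    exact (lintegral_prod _ (hm.enorm.pow_const q)).symm
  have hΦlim : Tendsto Φ (𝓝 0) (𝓝 0) :=
    (tendsto_lintegral_translate_sub hq hu huq).congr fun h => hΦiter h
  rw [ENNReal.tendsto_nhds_zero]
  intro ε hε
  obtain ⟨δ, hδ, hΦε⟩ : ∃ δ > 0, ∀ h : UnitAddTorus d, ‖h‖ < δ → Φ h ≤ ε := by
    have hev : ∀ᶠ h in 𝓝 (0 : UnitAddTorus d), Φ h ≤ ε :=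
      (ENNReal.tendsto_nhds_zero.1 hΦlim) ε hε
    obtain ⟨δ, hδ, hball⟩ := Metric.eventually_nhds_iff_ball.1 hev
    exact ⟨δ, hδ, fun h hh => hball h (by simpa [dist_zero_right] using hh)⟩
  filter_upwards [Ioo_mem_nhdsGT hδ] with ℓ hℓ
  set B : Set (EuclideanSpace ℝ d) := ball 0 ℓ with hB
  have hB0 : volume B ≠ 0 := (measure_ball_pos volume _ hℓ.1).ne'
  have hBtop : volume B ≠ ∞ := measure_ball_lt_top.ne
  calc (volume B)⁻¹ * ∫⁻ y in B, Φ (FunctionSpaces.Torus.proj y)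
      ≤ (volume B)⁻¹ * ∫⁻ _ in B, ε := by
        refine mul_le_mul' le_rfl (setLIntegral_mono_ae' measurableSet_ball ?_)
        refine ae_of_all _ fun y hy => ?_
        exact hΦε _ ((FunctionSpaces.Torus.norm_proj_le y).trans_lt
          ((mem_ball_zero_iff.1 hy).trans hℓ.2))
    _ = ε := by
        rw [setLIntegral_const, mul_comm ε, ← mul_assoc, ENNReal.inv_mul_cancel hB0 hBtop, one_mul]

end Modulus

/-! ## Weighted ball averages: the estimate at a fixed scale -/

section Fixed

/-- **Weighted ball averages are bounded in `L^q((0,T) × T^d)`** (Young/Jensen): for weights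
`w(y) : F → G` jointly continuous in `(y, v)` with `‖w(y) v‖ ≤ C ‖v‖` on `B_ℓ` (`ℓ > 0`), and a
jointly measurable field `u`, `∫₀ᵀ∫ ‖⨍_{B_ℓ} w(y) u(t, x + y) dy‖^q ≤ C^q ∫₀ᵀ∫ ‖u‖^q` for `q ≥ 1`,
in product form (Jensen on each ball, Tonelli, translation invariance of Haar measure). [folklore] -/
theorem lintegral_weightedBallAverage_rpow_le [Nonempty d] {q : ℝ} (hq : 1 ≤ q)
    (hu : AEStronglyMeasurable (uncurry u) ((volume.restrict (Ioo 0 T)).prod volume))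
    {w : EuclideanSpace ℝ d → F → G} {C ℓ : ℝ} (hℓ : 0 < ℓ) (hC : 0 ≤ C)
    (hw_cont : Continuous fun p : EuclideanSpace ℝ d × F => w p.1 p.2)
    (hw_bd : ∀ y ∈ ball (0 : EuclideanSpace ℝ d) ℓ, ∀ v, ‖w y v‖ ≤ C * ‖v‖) :
    ∫⁻ p, ‖⨍ y in ball (0 : EuclideanSpace ℝ d) ℓ, w y (u p.1 (p.2 + FunctionSpaces.Torus.proj y))‖ₑ ^ q
        ∂((volume.restrict (Ioo 0 T)).prod volume) ≤
      ENNReal.ofReal C ^ q * ∫⁻ p, ‖uncurry u p‖ₑ ^ q ∂((volume.restrict (Ioo 0 T)).prod volume) := by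
  have hq0 : 0 < q := one_pos.trans_le hq
  set μp : Measure (ℝ × UnitAddTorus d) := (volume.restrict (Ioo 0 T)).prod volume with hμp
  set B : Set (EuclideanSpace ℝ d) := ball 0 ℓ with hB
  have hB0 : volume B ≠ 0 := (measure_ball_pos volume _ hℓ).ne'
  have hBtop : volume B ≠ ∞ := measure_ball_lt_top.ne
  set ν : Measure (EuclideanSpace ℝ d) := volume.restrict B with hν
  have hyB : ∀ᵐ y ∂ν, y ∈ B := ae_restrict_mem measurableSet_ball
  have hT := aestronglyMeasurable_translate (ν := ν) hu FunctionSpaces.Torus.measurable_proj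
  have hWTm := aestronglyMeasurable_weight_translate ν hu hw_cont
  -- pointwise Jensen for a.e. `p`
  have hpt : ∀ᵐ p ∂μp, ‖⨍ y in B, w y (u p.1 (p.2 + FunctionSpaces.Torus.proj y))‖ₑ ^ q ≤
      ENNReal.ofReal C ^ q *
        ((volume B)⁻¹ * ∫⁻ y, ‖u p.1 (p.2 + FunctionSpaces.Torus.proj y)‖ₑ ^ q ∂ν) := by
    filter_upwards [hWTm.prodMk_left, hT.prodMk_left] with p hpW hpT
    calc ‖⨍ y in B, w y (u p.1 (p.2 + FunctionSpaces.Torus.proj y))‖ₑ ^ q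
        ≤ (volume B)⁻¹ * ∫⁻ y in B, ‖w y (u p.1 (p.2 + FunctionSpaces.Torus.proj y))‖ₑ ^ q :=
          enorm_setAverage_rpow_le hB0 hBtop hpW hq
      _ ≤ (volume B)⁻¹ * ∫⁻ y in B,
            ENNReal.ofReal C ^ q * ‖u p.1 (p.2 + FunctionSpaces.Torus.proj y)‖ₑ ^ q := by
          refine mul_le_mul' le_rfl (lintegral_mono_ae ?_)
          filter_upwards [hyB] with y hy
          rw [← ENNReal.mul_rpow_of_nonneg _ _ hq0.le]
          refine ENNReal.rpow_le_rpow ?_ hq0.le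
          rw [← ofReal_norm, ← ofReal_norm, ← ENNReal.ofReal_mul hC]
          exact ENNReal.ofReal_le_ofReal (hw_bd y hy _)
      _ = ENNReal.ofReal C ^ q *
            ((volume B)⁻¹ * ∫⁻ y, ‖u p.1 (p.2 + FunctionSpaces.Torus.proj y)‖ₑ ^ q ∂ν) := by
          rw [lintegral_const_mul'' _ (hpT.enorm.pow_const q), ← mul_assoc, ← mul_assoc,
            mul_comm _ (ENNReal.ofReal C ^ q)]
  -- integrate, swap, translation invariance
  have hinv : ∀ y, ∫⁻ p, ‖u p.1 (p.2 + FunctionSpaces.Torus.proj y)‖ₑ ^ q ∂μp =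
      ∫⁻ p, ‖uncurry u p‖ₑ ^ q ∂μp := fun y => by
    have h : MeasurePreserving (Prod.map id fun x : UnitAddTorus d => x + FunctionSpaces.Torus.proj y)
        μp μp := (MeasurePreserving.id _).prod (measurePreserving_add_right volume _)
    have hemb : MeasurableEmbedding
        (Prod.map id fun x : UnitAddTorus d => x + FunctionSpaces.Torus.proj y) :=
      (MeasurableEquiv.prodCongr (MeasurableEquiv.refl ℝ)
        (MeasurableEquiv.addRight (FunctionSpaces.Torus.proj y))).measurableEmbedding
    exact h.lintegral_comp_emb hemb (fun p => ‖uncurry u p‖ₑ ^ q)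
  have hm : AEMeasurable (fun p => ∫⁻ y, ‖u p.1 (p.2 + FunctionSpaces.Torus.proj y)‖ₑ ^ q ∂ν) μp :=
    (hT.enorm.pow_const q).lintegral_prod_right'
  calc ∫⁻ p, ‖⨍ y in B, w y (u p.1 (p.2 + FunctionSpaces.Torus.proj y))‖ₑ ^ q ∂μp
      ≤ ∫⁻ p, ENNReal.ofReal C ^ q *
          ((volume B)⁻¹ * ∫⁻ y, ‖u p.1 (p.2 + FunctionSpaces.Torus.proj y)‖ₑ ^ q ∂ν) ∂μp :=
        lintegral_mono_ae hpt
    _ = ENNReal.ofReal C ^ q *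
          ((volume B)⁻¹ * ∫⁻ y, ∫⁻ p, ‖u p.1 (p.2 + FunctionSpaces.Torus.proj y)‖ₑ ^ q ∂μp ∂ν) := by
        rw [lintegral_const_mul'' _ (hm.const_mul _), lintegral_const_mul'' _ hm,
          lintegral_lintegral_swap (hT.enorm.pow_const q)]
    _ = ENNReal.ofReal C ^ q * ∫⁻ p, ‖uncurry u p‖ₑ ^ q ∂μp := by
        simp only [hinv]
        rw [lintegral_const, hν, Measure.restrict_apply_univ, mul_comm _ (volume B), ← mul_assoc (volume B)⁻¹,
          ENNReal.inv_mul_cancel hB0 hBtop, one_mul]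

/-- **The weighted-average estimate at a fixed scale.** Let `w(y) : F → G` (`y ∈ ℝ^d`) be
linear weights, jointly continuous in `(y, v)`, with `‖w(y) v‖ ≤ C ‖v‖` for `y ∈ B_ℓ` and mass
`⨍_{B_ℓ} w(y) v dy = L v`. Then for a jointly measurable field `u` with `∫₀ᵀ∫ ‖u‖^q < ∞`, `1 ≤ q`,
in product form,
`∫₀ᵀ∫ ‖⨍_{B_ℓ} w(y) u(t, x + y) dy − L u(t, x)‖^q ≤ C^q |B_ℓ|⁻¹ ∫_{B_ℓ} ∫₀ᵀ∫ ‖u(t, x + y) − u(t, x)‖^q`: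
by linearity and the mass identity the difference is `⨍_{B_ℓ} w(y)(u(t, x + y) − u(t, x)) dy`
for a.e. `(t, x)`; Jensen on the ball and Tonelli. [folklore] -/
theorem lintegral_weightedBallAverage_sub_rpow_le [Nonempty d] {q : ℝ} (hq : 1 ≤ q)
    (hu : AEStronglyMeasurable (uncurry u) ((volume.restrict (Ioo 0 T)).prod volume))
    (huq : ∫⁻ t in Ioo 0 T, ∫⁻ x, ‖u t x‖ₑ ^ q < ∞)
    {w : EuclideanSpace ℝ d → F → G} {L : F → G} {C ℓ : ℝ} (hℓ : 0 < ℓ) (hC : 0 ≤ C)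
    (hw_sub : ∀ y a b, w y (a - b) = w y a - w y b)
    (hw_cont : Continuous fun p : EuclideanSpace ℝ d × F => w p.1 p.2)
    (hw_bd : ∀ y ∈ ball (0 : EuclideanSpace ℝ d) ℓ, ∀ v, ‖w y v‖ ≤ C * ‖v‖)
    (hw_mass : ∀ v, ⨍ y in ball (0 : EuclideanSpace ℝ d) ℓ, w y v = L v) :
    ∫⁻ p, ‖(⨍ y in ball (0 : EuclideanSpace ℝ d) ℓ, w y (u p.1 (p.2 + FunctionSpaces.Torus.proj y))) -
        L (u p.1 p.2)‖ₑ ^ q ∂((volume.restrict (Ioo 0 T)).prod volume) ≤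
      ENNReal.ofReal C ^ q * ((volume (ball (0 : EuclideanSpace ℝ d) ℓ))⁻¹ *
        ∫⁻ y in ball (0 : EuclideanSpace ℝ d) ℓ,
          ∫⁻ p, ‖u p.1 (p.2 + FunctionSpaces.Torus.proj y) - u p.1 p.2‖ₑ ^ q
            ∂((volume.restrict (Ioo 0 T)).prod volume)) := by
  have hq0 : 0 < q := one_pos.trans_le hq
  set μp : Measure (ℝ × UnitAddTorus d) := (volume.restrict (Ioo 0 T)).prod volume with hμp
  set B : Set (EuclideanSpace ℝ d) := ball 0 ℓ with hB
  have hB0 : volume B ≠ 0 := (measure_ball_pos volume _ hℓ).ne'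
  have hBtop : volume B ≠ ∞ := measure_ball_lt_top.ne
  have hBr : volume.real B ≠ 0 := (ENNReal.toReal_pos hB0 hBtop).ne'
  set ν : Measure (EuclideanSpace ℝ d) := volume.restrict B with hν
  haveI : IsFiniteMeasure ν := ⟨by rw [hν, Measure.restrict_apply_univ]; exact measure_ball_lt_top⟩
  have hyB : ∀ᵐ y ∂ν, y ∈ B := ae_restrict_mem measurableSet_ball
  -- the fields on the triple product
  set G0 : (ℝ × UnitAddTorus d) × EuclideanSpace ℝ d → F :=
    fun z => u z.1.1 (z.1.2 + FunctionSpaces.Torus.proj z.2) - u z.1.1 z.1.2 with hG0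
  have hTm := aestronglyMeasurable_translate (ν := ν) hu FunctionSpaces.Torus.measurable_proj
  have hG0m : AEStronglyMeasurable G0 (μp.prod ν) := aestronglyMeasurable_increment_proj ν hu
  have hWTm := aestronglyMeasurable_weight_translate ν hu hw_cont
  have hWGm : AEStronglyMeasurable (fun z => w z.2 (G0 z)) (μp.prod ν) :=
    aestronglyMeasurable_weight_increment ν hu hw_cont
  -- a.e. `p`: the translated slice is integrable on the ball
  have hint : ∀ᵐ p ∂μp, Integrable (fun y => u p.1 (p.2 + FunctionSpaces.Torus.proj y)) ν := by
    have hfin : ∫⁻ z, ‖u z.1.1 (z.1.2 + FunctionSpaces.Torus.proj z.2)‖ₑ ∂(μp.prod ν) < ∞ := by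
      have h1 := lintegral_mul_translate_enorm_pow (ν := ν) hu FunctionSpaces.Torus.measurable_proj
        (w := fun _ => 1) aemeasurable_const 1
      simp only [one_mul, pow_one, lintegral_const] at h1
      rw [h1]
      refine ENNReal.mul_lt_top (by rw [hν, Measure.restrict_apply_univ]; exact measure_ball_lt_top) ?_
      haveI : IsFiniteMeasure μp := by rw [hμp]; infer_instance
      have hmem : MemLp (uncurry u) (ENNReal.ofReal q) μp := by
        refine ⟨hu, ?_⟩
        rw [← ENNReal.rpow_lt_top_iff_of_pos hq0, ← lintegral_enorm_rpow_eq_eLpNorm_rpow hq0, hμp,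
          lintegral_prod _ (hu.enorm.pow_const q)]
        exact huq
      have h1' : (1 : ℝ≥0∞) ≤ ENNReal.ofReal q := by
        rw [← ENNReal.ofReal_one]; exact ENNReal.ofReal_le_ofReal hq
      have := (hmem.mono_exponent h1').2
      rwa [eLpNorm_one_eq_lintegral_enorm] at this
    have hsecfin : ∀ᵐ p ∂μp, ∫⁻ y, ‖u p.1 (p.2 + FunctionSpaces.Torus.proj y)‖ₑ ∂ν < ∞ :=
      ae_lt_top' (hTm.enorm.lintegral_prod_right')
        (by rw [lintegral_prod _ hTm.enorm] at hfin; exact hfin.ne)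
    filter_upwards [hTm.prodMk_left, hsecfin] with p hp hpf
    exact ⟨hp, hpf⟩
  -- Step 1: pointwise, for a.e. `p = (t, x)`
  have hpt : ∀ᵐ p ∂μp,
      ‖(⨍ y in B, w y (u p.1 (p.2 + FunctionSpaces.Torus.proj y))) - L (u p.1 p.2)‖ₑ ^ q ≤
        ENNReal.ofReal C ^ q * ((volume B)⁻¹ * ∫⁻ y, ‖G0 (p, y)‖ₑ ^ q ∂ν) := by
    filter_upwards [hint, hWTm.prodMk_left, hWGm.prodMk_left, hG0m.prodMk_left] with p hpi hpW hpWG hpG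
    -- integrability of the two weighted slices
    have hI1 : Integrable (fun y => w y (u p.1 (p.2 + FunctionSpaces.Torus.proj y))) ν := by
      refine Integrable.mono' (hpi.norm.const_mul C) hpW ?_
      filter_upwards [hyB] with y hy
      exact hw_bd y hy _
    have hI2 : Integrable (fun y => w y (u p.1 p.2)) ν := by
      refine Integrable.mono' (integrable_const (C * ‖u p.1 p.2‖)) ?_ ?_
      · exact (hw_cont.comp (continuous_id.prodMk continuous_const)).aestronglyMeasurable
      · filter_upwards [hyB] with y hy
        exact hw_bd y hy _
    -- the difference is the weighted average of the increment
    have havg : (⨍ y in B, w y (u p.1 (p.2 + FunctionSpaces.Torus.proj y))) - L (u p.1 p.2) =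
        ⨍ y in B, w y (G0 (p, y)) := by
      rw [← hw_mass (u p.1 p.2), setAverage_eq, setAverage_eq, setAverage_eq, ← smul_sub,
        ← integral_sub hI1 hI2]
      congr 1
      refine integral_congr_ae (ae_of_all _ fun y => ?_)
      simp only [hG0]
      exact (hw_sub y _ _).symm
    rw [havg]
    -- Jensen and the bound on the weight
    calc ‖⨍ y in B, w y (G0 (p, y))‖ₑ ^ q ≤ (volume B)⁻¹ * ∫⁻ y in B, ‖w y (G0 (p, y))‖ₑ ^ q :=
          enorm_setAverage_rpow_le hB0 hBtop hpWG hq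
      _ ≤ (volume B)⁻¹ * ∫⁻ y in B, ENNReal.ofReal C ^ q * ‖G0 (p, y)‖ₑ ^ q := by
          refine mul_le_mul' le_rfl (lintegral_mono_ae ?_)
          filter_upwards [hyB] with y hy
          rw [← ENNReal.mul_rpow_of_nonneg _ _ hq0.le]
          refine ENNReal.rpow_le_rpow ?_ hq0.le
          rw [← ofReal_norm, ← ofReal_norm, ← ENNReal.ofReal_mul hC]
          exact ENNReal.ofReal_le_ofReal (hw_bd y hy _)
      _ = ENNReal.ofReal C ^ q * ((volume B)⁻¹ * ∫⁻ y, ‖G0 (p, y)‖ₑ ^ q ∂ν) := by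
          rw [lintegral_const_mul'' _ (hpG.enorm.pow_const q), ← mul_assoc, ← mul_assoc,
            mul_comm _ (ENNReal.ofReal C ^ q)]
  -- Step 2: integrate and swap (Tonelli)
  calc ∫⁻ p, ‖(⨍ y in B, w y (u p.1 (p.2 + FunctionSpaces.Torus.proj y))) - L (u p.1 p.2)‖ₑ ^ q ∂μp
      ≤ ∫⁻ p, ENNReal.ofReal C ^ q * ((volume B)⁻¹ * ∫⁻ y, ‖G0 (p, y)‖ₑ ^ q ∂ν) ∂μp :=
        lintegral_mono_ae hpt
    _ = ENNReal.ofReal C ^ q * ((volume B)⁻¹ * ∫⁻ y, ∫⁻ p, ‖G0 (p, y)‖ₑ ^ q ∂μp ∂ν) := by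
        have hm : AEMeasurable (fun p => ∫⁻ y, ‖G0 (p, y)‖ₑ ^ q ∂ν) μp :=
          (hG0m.enorm.pow_const q).lintegral_prod_right'
        rw [lintegral_const_mul'' _ (hm.const_mul _), lintegral_const_mul'' _ hm,
          lintegral_lintegral_swap (hG0m.enorm.pow_const q)]

end Fixed

/-! ## Weighted ball averages converge in `L^q((0,T) × T^d)` -/

section Limit

/-- **Weighted ball averages converge in `L^q((0,T) × T^d)`** (the `L^p` claim of Novack 2024,
§2 Step 2, for a general bounded linear weight; Folland, *Real Analysis*, Thm. 8.14 (a) with a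
matrix-valued kernel). Let `w_ℓ(y) : F → G` be linear weights, jointly continuous in `(y, v)`,
with `‖w_ℓ(y) v‖ ≤ C ‖v‖` for `y ∈ B_ℓ` and common mass `⨍_{B_ℓ} w_ℓ(y) v dy = L v` for all
`0 < ℓ < ℓ₀`, `L` continuous. Then for a jointly measurable field `u` with `∫₀ᵀ∫ ‖u‖^q < ∞`,
`1 ≤ q`, `∫₀ᵀ∫ ‖⨍_{B_ℓ} w_ℓ(y) u(t, x + y) dy − L u(t, x)‖^q dx dt → 0` as `ℓ → 0⁺`, the
separation `y ∈ ℝ^d` acting through the covering map. [cite: Novack2024, Sect. 2 Step 2 (claim)] -/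
theorem tendsto_lintegral_weightedBallAverage_sub [Nonempty d] {q : ℝ} (hq : 1 ≤ q)
    (hu : AEStronglyMeasurable (uncurry u) ((volume.restrict (Ioo 0 T)).prod volume))
    (huq : ∫⁻ t in Ioo 0 T, ∫⁻ x, ‖u t x‖ₑ ^ q < ∞)
    {w : ℝ → EuclideanSpace ℝ d → F → G} {L : F → G} {C ℓ₀ : ℝ} (hℓ₀ : 0 < ℓ₀) (hC : 0 ≤ C)
    (hL : Continuous L)
    (hw_sub : ∀ ℓ y a b, w ℓ y (a - b) = w ℓ y a - w ℓ y b)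
    (hw_cont : ∀ ℓ, Continuous fun p : EuclideanSpace ℝ d × F => w ℓ p.1 p.2)
    (hw_bd : ∀ ℓ ∈ Ioo 0 ℓ₀, ∀ y ∈ ball (0 : EuclideanSpace ℝ d) ℓ, ∀ v, ‖w ℓ y v‖ ≤ C * ‖v‖)
    (hw_mass : ∀ ℓ ∈ Ioo 0 ℓ₀, ∀ v, ⨍ y in ball (0 : EuclideanSpace ℝ d) ℓ, w ℓ y v = L v) :
    Tendsto (fun ℓ : ℝ => ∫⁻ t in Ioo 0 T, ∫⁻ x,
        ‖(⨍ y in ball (0 : EuclideanSpace ℝ d) ℓ, w ℓ y (u t (x + FunctionSpaces.Torus.proj y))) -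
          L (u t x)‖ₑ ^ q) (𝓝[>] 0) (𝓝 0) := by
  set μp : Measure (ℝ × UnitAddTorus d) := (volume.restrict (Ioo 0 T)).prod volume with hμp
  -- the bound tends to zero
  have hmod := tendsto_ballAverage_translationModulus (d := d) hq hu huq
  have hbound := ENNReal.Tendsto.const_mul hmod (a := ENNReal.ofReal C ^ q)
    (Or.inr (ENNReal.rpow_ne_top_of_nonneg (one_pos.trans_le hq).le ENNReal.ofReal_ne_top))
  rw [mul_zero] at hbound
  refine tendsto_of_tendsto_of_tendsto_of_le_of_le' tendsto_const_nhds hbound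
    (Eventually.of_forall fun _ => zero_le) ?_
  filter_upwards [Ioo_mem_nhdsGT hℓ₀] with ℓ hℓ
  -- iterated form = product form, then the fixed-scale estimate
  have hAm : AEStronglyMeasurable (uncurry fun t x =>
      (⨍ y in ball (0 : EuclideanSpace ℝ d) ℓ, w ℓ y (u t (x + FunctionSpaces.Torus.proj y))) -
        L (u t x)) μp :=
    (aestronglyMeasurable_weightedBallAverage hu (hw_cont ℓ) _).sub (hL.comp_aestronglyMeasurable hu)
  have hprod : ∫⁻ t in Ioo 0 T, ∫⁻ x,
      ‖(⨍ y in ball (0 : EuclideanSpace ℝ d) ℓ, w ℓ y (u t (x + FunctionSpaces.Torus.proj y))) -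
        L (u t x)‖ₑ ^ q =
      ∫⁻ p, ‖(⨍ y in ball (0 : EuclideanSpace ℝ d) ℓ,
          w ℓ y (u p.1 (p.2 + FunctionSpaces.Torus.proj y))) - L (u p.1 p.2)‖ₑ ^ q ∂μp :=
    (lintegral_prod (fun p : ℝ × UnitAddTorus d =>
      ‖(⨍ y in ball (0 : EuclideanSpace ℝ d) ℓ, w ℓ y (u p.1 (p.2 + FunctionSpaces.Torus.proj y))) -
        L (u p.1 p.2)‖ₑ ^ q) (hAm.enorm.pow_const q)).symm
  rw [hprod]
  exact lintegral_weightedBallAverage_sub_rpow_le hq hu huq hℓ.1 hC (hw_sub ℓ) (hw_cont ℓ)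
    (hw_bd ℓ hℓ) (hw_mass ℓ hℓ)

end Limit

end Literature.Analysis.FluidPDE.Torus
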